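import Summits.MatrixMultiplication.MatrixMultiplication.Theorems.SaturationLadderTwinCeilingPencil
import HarnessLib

/-!
# SaturationLadder — twin-class ceiling (3/3): `Base(θ)` for every `θ³ > 3125/128`; the crux is the grades `θ³ ≤ 3125/128`

Route `SaturationLadder` (sub-problem `MatrixMultiplication`), crux `SubexpSaturation`
(stmt-MatrixMultiplication-25909) `⟺ ∀ θ > 1, Base(θ)`
(`SaturationLadderBaseFamily.subexpSaturation_iff_forall_base`), where
`Base(θ) :≡ ∃ C, ∀ t ∈ [0,1), ∃ r, 1 ≤ r ≤ C · θ^{1/(1−t)} ∧ ω(1,t,r) ≤ 1 + r` (written out verbatim;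
no definition is introduced).

State before this file: `Base(θ)` is a theorem for every `θ ≥ θ_F = 2^{47/30} = 2.9622…`, the constant
of the ONE landed STAGE-2 twin family (`SaturationLadderFamilyConstant.base_of_ge_family`), while the
in-class optimum of twin-tensor certificates computed in the cell (gen 8, `twin-family-tables-g8.txt`,
TABLE 3/4) is `c₂ = (5 log 5 − 7 log 2)/3 = 1.06505…`, i.e. the base `e^{c₂} = (5⁵/2⁷)^{1/3} =
(3125/128)^{1/3} = 2.90099…`.  The three-file move `SaturationLadderTwinCeilingCore` (the two
entropy inequalities as real analysis: `coreY`, `coreX`) → `SaturationLadderTwinCeilingPencil` (the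
ONE-PARAMETER PENCIL of twin families `κ = p/q`, counts `× 2qj`: `n₁ = 3qj + 2q`,
`n₃ = 3qj + 2q + 2p`, `n₂ = 2qj·2^{j+1} − n₃`, `n₄ = qj − 2q`, `n₅ = 0`, `n₆ = 2qj`, the landed family
being `(p, q) = (17, 20)`; its growth `2^j ≤ (2^{(3q+2p)/(3q)})^{1/(1−t_j)}` and its entropy hypotheses
`paramY`, `paramX` for every `κ ∈ [0, 1]` above the `Y`-threshold

  `δ(κ) := (5/2 + κ) log 2 − (5/2) log (5/2) > 0`, for all `j ≥ max(1000, 30/δ(κ))`)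

→ this file closes that gap completely: it reads off `Base(2^{1 + 2κ/3})` along the pencil, and since
`δ(κ) > 0 ⟺ κ > κ₀ := (5/2)·log₂(5/2) − 5/2 = 0.8048…` and `2^{1 + 2κ₀/3} = (3125/128)^{1/3}`,
density of `p/q` gives:

* `rEq`, `four_le_r`, `one_le_r`, `r_le`: the ordinate `4 ≤ r_j ≤ 2^{j+1}` along the pencil (counts as
  variables bound by the count equations, as in `…TwinCeilingPencil`);
* `saturationBase_param`: `Base(2^{(3q+2p)/(3q)})` for all naturals `p ≤ q`, `0 < q`, `δ(p/q) > 0`;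
* **`base_of_cube_gt`** : `Base(θ)` for EVERY `θ > 0` with `θ³ > 3125/128` — the theorem frontier of
  the base ladder now sits exactly at the twin-class ceiling `(3125/128)^{1/3} = 2.90099…`
  (`base_2901 : Base(2.901)`; `2.9³ < 3125/128 < 2.901³`);
* **`subexpSaturation_iff_base_cube_le`** : `SubexpSaturation ⟺ ∀ θ > 1, θ³ ≤ 3125/128 → Base(θ)` —
  the open content of the crux is exactly the grades `θ ∈ (1, (3125/128)^{1/3}]`, none of which has a
  certificate of twin type (cell record: below this constant a new certificate CLASS is needed; the
  recorded next design, the null-algebra two-copy family of gen 9, is priced at `≈ 2.8997`).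

Margins (why `30/δ`): with `ε = 1/j`, `d · (H(Y_j) − H(Z_j)) ≥ δ − (1−κ) ε log 2 − (1+κ) ε log(5/2) −
3.6 ε² − 25/2^{j+1} ≥ δ − 27.6 ε` and `d · (H(X_j) − H(Z_j)) ≥ δ + 0.014 − 26.3 ε` (nats); numerically
checked against the exact entropies for `κ ∈ {17/20, 33/40, 13/16, 81/100, 403/500, 8051/10⁴}`
(cell `decomp-mm`, lens 1 «grading / quantitative ladder», gen 14, `gen14/param_check2.py`).
No definitions, no named facts, no sorry.
-/

set_option linter.dupNamespace false
-- (single-conjunct summit: the namespace repeats `MatrixMultiplication`)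

noncomputable section

namespace Summit.MatrixMultiplication.MatrixMultiplication.Theorems.SaturationLadderTwinCeiling

open Literature.Computability.AlgebraicComplexity
open Summit.MatrixMultiplication.MatrixMultiplication.Theorems.SaturationLadderTwinExact
  (omegaRect_one_tw_exact)
open Summit.MatrixMultiplication.MatrixMultiplication.Theorems.SaturationLadderTwinSaturation
  (log_five_halves_le)
open Summit.MatrixMultiplication.MatrixMultiplication.Theorems.SaturationLadderSubThreeSaturation
  (baseSaturation_of_certificates)
open Summit.MatrixMultiplication.MatrixMultiplication.Theses.SaturationLadder
  (SubexpSaturation)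
open Summit.MatrixMultiplication.MatrixMultiplication.Theorems.SaturationLadderBaseFamily
  (base_mono subexpSaturation_iff_forall_base)
open Summit.MatrixMultiplication.MatrixMultiplication.Theorems.SaturationLadderTwinCeilingPencil

/-! ## The ordinate `r_j = ((j+1) n₂ + n₁ + n₄) / ((j+1) n₃ + n₅)` along the pencil -/

/-- `r_j` in closed form, for counts bound by the count equations. [folklore] -/
theorem rEq (p q j n₁ n₂ n₃ n₄ : ℕ) (h₁ : n₁ = 3 * q * j + 2 * q)
    (h₂ : n₂ + (3 * q * j + 2 * q + 2 * p) = 2 * q * j * 2 ^ (j + 1))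
    (h₃ : n₃ = 3 * q * j + 2 * q + 2 * p) (h₄ : n₄ + 2 * q = q * j) :
    (((j : ℝ) + 1) * n₂ + n₁ + n₄) / (((j : ℝ) + 1) * n₃ + ((0 : ℕ) : ℝ)) =
      (((j : ℝ) + 1) * (2 * q * j * (2 : ℝ) ^ (j + 1) - (3 * q * j + 2 * q + 2 * p)) +
        (3 * q * j + 2 * q) + (q * j - 2 * q)) / (((j : ℝ) + 1) * (3 * q * j + 2 * q + 2 * p)) := by
  have c₁ : (n₁ : ℝ) = 3 * q * j + 2 * q := by rw [h₁]; push_cast; ring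
  have c₂ : (n₂ : ℝ) = 2 * q * j * (2 : ℝ) ^ (j + 1) - (3 * q * j + 2 * q + 2 * p) := by
    have h := congrArg (Nat.cast : ℕ → ℝ) h₂
    push_cast at h
    linarith
  have c₃ : (n₃ : ℝ) = 3 * q * j + 2 * q + 2 * p := by rw [h₃]; push_cast; ring
  have c₄ : (n₄ : ℝ) = q * j - 2 * q := by
    have h := congrArg (Nat.cast : ℕ → ℝ) h₄
    push_cast at h
    linarith
  rw [c₁, c₂, c₃, c₄]
  push_cast
  try ring

/-- `4 ≤ r_j` (`j ≥ 3`, `0 < q`, `p ≤ q`). [folklore] -/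
theorem four_le_r (p q j n₁ n₂ n₃ n₄ : ℕ) (h₁ : n₁ = 3 * q * j + 2 * q)
    (h₂ : n₂ + (3 * q * j + 2 * q + 2 * p) = 2 * q * j * 2 ^ (j + 1))
    (h₃ : n₃ = 3 * q * j + 2 * q + 2 * p) (h₄ : n₄ + 2 * q = q * j)
    (hq : 0 < q) (hpq : p ≤ q) (hj : 3 ≤ j) :
    4 ≤ (((j : ℝ) + 1) * n₂ + n₁ + n₄) / (((j : ℝ) + 1) * n₃ + ((0 : ℕ) : ℝ)) := by
  have hq' : (0 : ℝ) < q := by exact_mod_cast hq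
  have hpq' : (p : ℝ) ≤ q := by exact_mod_cast hpq
  have hj' : (3 : ℝ) ≤ j := by exact_mod_cast hj
  rw [rEq p q j n₁ n₂ n₃ n₄ h₁ h₂ h₃ h₄, le_div_iff₀ (by positivity)]
  have h16 : (16 : ℝ) ≤ (2 : ℝ) ^ (j + 1) := by
    calc (16 : ℝ) = 2 ^ 4 := by norm_num
      _ ≤ 2 ^ (j + 1) := pow_le_pow_right₀ (by norm_num) (by omega)
  have hprod := mul_le_mul_of_nonneg_left h16 (by positivity : (0 : ℝ) ≤ ((j : ℝ) + 1) * q * j)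
  have hpj : (p : ℝ) * j ≤ q * j := mul_le_mul_of_nonneg_right hpq' (by positivity)
  have hqj : (q : ℝ) * 3 ≤ q * j := mul_le_mul_of_nonneg_left hj' hq'.le
  have hqjj : (q : ℝ) * j * 3 ≤ q * j * j := mul_le_mul_of_nonneg_left hj' (by positivity)
  have e : ((j : ℝ) + 1) * (2 * q * j * (2 : ℝ) ^ (j + 1) - (3 * q * j + 2 * q + 2 * p)) +
      (3 * q * j + 2 * q) + (q * j - 2 * q) =
      2 * (((j : ℝ) + 1) * q * j * (2 : ℝ) ^ (j + 1)) - ((j : ℝ) + 1) * (3 * q * j + 2 * q + 2 * p) +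
        4 * q * j := by ring
  rw [e]
  nlinarith [hprod, hpj, hqj, hqjj, hq'.le, hpq']

/-- `1 ≤ r_j` (`j ≥ 3`). [folklore] -/
theorem one_le_r (p q j n₁ n₂ n₃ n₄ : ℕ) (h₁ : n₁ = 3 * q * j + 2 * q)
    (h₂ : n₂ + (3 * q * j + 2 * q + 2 * p) = 2 * q * j * 2 ^ (j + 1))
    (h₃ : n₃ = 3 * q * j + 2 * q + 2 * p) (h₄ : n₄ + 2 * q = q * j)
    (hq : 0 < q) (hpq : p ≤ q) (hj : 3 ≤ j) :
    1 ≤ (((j : ℝ) + 1) * n₂ + n₁ + n₄) / (((j : ℝ) + 1) * n₃ + ((0 : ℕ) : ℝ)) :=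
  (by norm_num : (1 : ℝ) ≤ 4).trans (four_le_r p q j n₁ n₂ n₃ n₄ h₁ h₂ h₃ h₄ hq hpq hj)

/-- `r_j ≤ 2^{j+1}` (`j ≥ 2`). [folklore] -/
theorem r_le (p q j n₁ n₂ n₃ n₄ : ℕ) (h₁ : n₁ = 3 * q * j + 2 * q)
    (h₂ : n₂ + (3 * q * j + 2 * q + 2 * p) = 2 * q * j * 2 ^ (j + 1))
    (h₃ : n₃ = 3 * q * j + 2 * q + 2 * p) (h₄ : n₄ + 2 * q = q * j)
    (hq : 0 < q) (hj : 2 ≤ j) :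
    (((j : ℝ) + 1) * n₂ + n₁ + n₄) / (((j : ℝ) + 1) * n₃ + ((0 : ℕ) : ℝ)) ≤ (2 : ℝ) ^ (j + 1) := by
  have hq' : (0 : ℝ) < q := by exact_mod_cast hq
  rw [rEq p q j n₁ n₂ n₃ n₄ h₁ h₂ h₃ h₄, div_le_iff₀ (by positivity)]
  have h8 : (8 : ℝ) ≤ (2 : ℝ) ^ (j + 1) := by
    calc (8 : ℝ) = 2 ^ 3 := by norm_num
      _ ≤ 2 ^ (j + 1) := pow_le_pow_right₀ (by norm_num) (by omega)
  have hprod := mul_le_mul_of_nonneg_left h8 (by positivity : (0 : ℝ) ≤ ((j : ℝ) + 1) * q * j)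
  have ha : (0 : ℝ) ≤ (2 : ℝ) ^ (j + 1) * (((j : ℝ) + 1) * (2 * q + 2 * p)) := by positivity
  have hb : (0 : ℝ) ≤ ((j : ℝ) + 1) * (3 * q * j + 2 * q + 2 * p) := by positivity
  have hj1 : (1 : ℝ) ≤ (j : ℝ) + 1 := by linarith [(Nat.cast_nonneg j : (0 : ℝ) ≤ j)]
  have e1 : ((j : ℝ) + 1) * (2 * q * j * (2 : ℝ) ^ (j + 1) - (3 * q * j + 2 * q + 2 * p)) +
      (3 * q * j + 2 * q) + (q * j - 2 * q) =
      2 * (((j : ℝ) + 1) * q * j * (2 : ℝ) ^ (j + 1)) - ((j : ℝ) + 1) * (3 * q * j + 2 * q + 2 * p) +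
        4 * q * j := by ring
  have e2 : (2 : ℝ) ^ (j + 1) * (((j : ℝ) + 1) * (3 * q * j + 2 * q + 2 * p)) =
      3 * (((j : ℝ) + 1) * q * j * (2 : ℝ) ^ (j + 1)) +
        (2 : ℝ) ^ (j + 1) * (((j : ℝ) + 1) * (2 * q + 2 * p)) := by ring
  rw [e1, e2]
  have hqj0 : (0 : ℝ) ≤ q * j := by positivity
  nlinarith [hprod, ha, hb, hqj0, hj1]

/-! ## The rung along the pencil -/

/-- **`Base(2^{(3q+2p)/(3q)})` for every member `κ = p/q` of the pencil above the `Y`-threshold**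
(`0 < q`, `p ≤ q`, `(5/2) log(5/2) < (5/2 + p/q) log 2`): there is `C` (here `C = r_{j₀}`,
`j₀ = max(1000, ⌈30/δ⌉)`) such that for every `t ∈ [0, 1)` some
`r ∈ [1, C · (2^{(3q+2p)/(3q)})^{1/(1−t)}]` has `ω(1, t, r) ≤ 1 + r`.  The certificates are
`omegaRect_one_tw_exact` at the explicit counts `(3qj+2q, 2qj·2^{j+1} − (3qj+2q+2p), 3qj+2q+2p,
qj − 2q, 0, 2qj)`, `j ≥ j₀`, with `paramX` / `paramY` as entropy hypotheses.
[cite: CoppersmithWinograd1990, §8] [cite: AlmanDuanVassilevskaWilliamsXuXuZhou2025, Thm. 3.2, §3.4] -/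
theorem saturationBase_param (p q : ℕ) (hq : 0 < q) (hpq : p ≤ q)
    (hδ : 5 / 2 * Real.log (5 / 2) < (5 / 2 + (p : ℝ) / q) * Real.log 2) :
    ∃ C : ℝ, ∀ t : ℝ, 0 ≤ t → t < 1 →
      ∃ r : ℝ, 1 ≤ r ∧ r ≤ C * ((2 : ℝ) ^ ((3 * (q : ℝ) + 2 * p) / (3 * q))) ^ (1 / (1 - t)) ∧
        omegaRect ℂ 1 t r ≤ 1 + r := by
  -- the threshold `j₀ = max(1000, ⌈30/δ⌉)`
  set δ : ℝ := (5 / 2 + (p : ℝ) / q) * Real.log 2 - 5 / 2 * Real.log (5 / 2) with hδdef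
  have hδpos : 0 < δ := by rw [hδdef]; linarith
  obtain ⟨j₁, hj₁⟩ := exists_nat_ge (30 / δ)
  obtain ⟨j₀, hj₀1, hj₀2⟩ : ∃ j₀ : ℕ, 1000 ≤ j₀ ∧ j₁ ≤ j₀ := ⟨max 1000 j₁, le_max_left _ _, le_max_right _ _⟩
  have hjδ : ∀ k : ℕ, 30 ≤ ((j₀ + k : ℕ) : ℝ) * δ := fun k => by
    have h1 : 30 / δ ≤ ((j₀ + k : ℕ) : ℝ) := hj₁.trans (by exact_mod_cast (by omega : j₁ ≤ j₀ + k))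
    rwa [div_le_iff₀ hδpos] at h1
  have hθ1 : (1 : ℝ) ≤ (2 : ℝ) ^ ((3 * (q : ℝ) + 2 * p) / (3 * q)) :=
    Real.one_le_rpow (by norm_num) (by positivity)
  -- the two count equations with a subtraction, at `j = j₀ + k`
  have hc₂ : ∀ m : ℕ, 1 ≤ m →
      2 * q * m * 2 ^ (m + 1) - (3 * q * m + 2 * q + 2 * p) + (3 * q * m + 2 * q + 2 * p) =
        2 * q * m * 2 ^ (m + 1) := fun m hm => Nat.sub_add_cancel (le_cnt_aux p q m hpq hm)
  have hc₄ : ∀ m : ℕ, 2 ≤ m → q * m - 2 * q + 2 * q = q * m := fun m hm =>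
    Nat.sub_add_cancel (two_q_le q m hm)
  -- the abscissae and ordinates of the certificates, as sequences
  obtain ⟨t, ht⟩ : ∃ t : ℕ → ℝ, ∀ k, t k =
      (((j₀ + k : ℕ) : ℝ) * ((3 * q * (j₀ + k) + 2 * q : ℕ) : ℝ)) /
        ((((j₀ + k : ℕ) : ℝ) + 1) * ((3 * q * (j₀ + k) + 2 * q + 2 * p : ℕ) : ℝ) + ((0 : ℕ) : ℝ)) :=
    ⟨fun k => (((j₀ + k : ℕ) : ℝ) * ((3 * q * (j₀ + k) + 2 * q : ℕ) : ℝ)) /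
        ((((j₀ + k : ℕ) : ℝ) + 1) * ((3 * q * (j₀ + k) + 2 * q + 2 * p : ℕ) : ℝ) + ((0 : ℕ) : ℝ)),
      fun k => rfl⟩
  obtain ⟨r, hr⟩ : ∃ r : ℕ → ℝ, ∀ k, r k =
      ((((j₀ + k : ℕ) : ℝ) + 1) *
            ((2 * q * (j₀ + k) * 2 ^ (j₀ + k + 1) - (3 * q * (j₀ + k) + 2 * q + 2 * p) : ℕ) : ℝ) +
          ((3 * q * (j₀ + k) + 2 * q : ℕ) : ℝ) + ((q * (j₀ + k) - 2 * q : ℕ) : ℝ)) /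
        ((((j₀ + k : ℕ) : ℝ) + 1) * ((3 * q * (j₀ + k) + 2 * q + 2 * p : ℕ) : ℝ) + ((0 : ℕ) : ℝ)) :=
    ⟨fun k => ((((j₀ + k : ℕ) : ℝ) + 1) *
            ((2 * q * (j₀ + k) * 2 ^ (j₀ + k + 1) - (3 * q * (j₀ + k) + 2 * q + 2 * p) : ℕ) : ℝ) +
          ((3 * q * (j₀ + k) + 2 * q : ℕ) : ℝ) + ((q * (j₀ + k) - 2 * q : ℕ) : ℝ)) /
        ((((j₀ + k : ℕ) : ℝ) + 1) * ((3 * q * (j₀ + k) + 2 * q + 2 * p : ℕ) : ℝ) + ((0 : ℕ) : ℝ)),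
      fun k => rfl⟩
  have hr1 : ∀ k, 1 ≤ r k := fun k => by
    rw [hr]
    exact one_le_r p q (j₀ + k) _ _ _ _ rfl (hc₂ (j₀ + k) (by omega)) rfl (hc₄ (j₀ + k) (by omega))
      hq hpq (by omega)
  have hsat : ∀ k, omegaRect ℂ 1 (t k) (r k) ≤ 1 + r k := fun k => by
    rw [ht, hr]
    exact omegaRect_one_tw_exact (j₀ + k) (3 * q * (j₀ + k) + 2 * q)
      (2 * q * (j₀ + k) * 2 ^ (j₀ + k + 1) - (3 * q * (j₀ + k) + 2 * q + 2 * p))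
      (3 * q * (j₀ + k) + 2 * q + 2 * p) (q * (j₀ + k) - 2 * q) 0 (2 * q * (j₀ + k))
      (cnt₆_pos q (j₀ + k) hq (by omega)) (cnt_add₁₄ q (j₀ + k) (by omega))
      (cnt_add₂₃ p q (j₀ + k) hpq (by omega)) (cnt₃_pos p q (j₀ + k) hq)
      (paramX p q (j₀ + k) _ _ _ _ _ hq hpq (by omega) (hjδ k) rfl (hc₂ (j₀ + k) (by omega)) rfl
        (hc₄ (j₀ + k) (by omega)) rfl)
      (paramY p q (j₀ + k) _ _ _ _ _ hq hpq (by omega) (hjδ k) rfl (hc₂ (j₀ + k) (by omega)) rfl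
        (hc₄ (j₀ + k) (by omega)) rfl)
  have hcov : ∀ s : ℝ, s < 1 → ∃ k, s ≤ t k := fun s hs => by
    -- the abscissae exhaust `[0,1)`: `1 − t_j ≤ 2/j`
    obtain ⟨k, hk⟩ := exists_nat_ge (2 / (1 - s))
    refine ⟨k, ?_⟩
    have h1s : 0 < 1 - s := by linarith
    have hjpos : (0 : ℝ) < ((j₀ + k : ℕ) : ℝ) := by
      have : (1 : ℝ) ≤ ((j₀ + k : ℕ) : ℝ) := by exact_mod_cast (by omega : 1 ≤ j₀ + k)
      linarith
    have hle := one_sub_t_le p q (j₀ + k) (3 * q * (j₀ + k) + 2 * q)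
      (3 * q * (j₀ + k) + 2 * q + 2 * p) rfl rfl hq hpq (by omega)
    have hk' : 2 / (1 - s) ≤ ((j₀ + k : ℕ) : ℝ) :=
      hk.trans (by push_cast; linarith [(Nat.cast_nonneg j₀ : (0 : ℝ) ≤ j₀)])
    have h2 : 2 / ((j₀ + k : ℕ) : ℝ) ≤ 1 - s := by
      rw [div_le_iff₀ hjpos]
      have := (div_le_iff₀ h1s).1 hk'
      linarith
    rw [ht]
    linarith
  have h0 : r 0 ≤ (2 : ℝ) ^ ((3 * (q : ℝ) + 2 * p) / (3 * q)) * r 0 :=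
    le_mul_of_one_le_left (by linarith [hr1 0]) hθ1
  have hstep : ∀ k, r (k + 1) ≤
      r 0 * ((2 : ℝ) ^ ((3 * (q : ℝ) + 2 * p) / (3 * q))) ^ (1 / (1 - t k)) := fun k => by
    -- growth: `r_{j+1} ≤ 2^{j+2} = 4 · 2^j ≤ r_{j₀} · θ^{1/(1−t_j)}`
    have h1 : r (k + 1) ≤ (2 : ℝ) ^ (j₀ + (k + 1) + 1) := by
      rw [hr]
      exact r_le p q (j₀ + (k + 1)) _ _ _ _ rfl (hc₂ (j₀ + (k + 1)) (by omega)) rfl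
        (hc₄ (j₀ + (k + 1)) (by omega)) hq (by omega)
    have h2 : (2 : ℝ) ^ (j₀ + k) ≤
        ((2 : ℝ) ^ ((3 * (q : ℝ) + 2 * p) / (3 * q))) ^ (1 / (1 - t k)) := by
      rw [ht]
      exact two_pow_le_rpow_pencil p q (j₀ + k) _ _ rfl rfl hq
    have h3 : 4 ≤ r 0 := by
      rw [hr]
      exact four_le_r p q (j₀ + 0) _ _ _ _ rfl (hc₂ (j₀ + 0) (by omega)) rfl (hc₄ (j₀ + 0) (by omega))
        hq hpq (by omega)
    have e : (2 : ℝ) ^ (j₀ + (k + 1) + 1) = 4 * (2 : ℝ) ^ (j₀ + k) := by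
      rw [show j₀ + (k + 1) + 1 = (j₀ + k) + 2 from by omega, pow_add, mul_comm]
      norm_num
    rw [e] at h1
    have h4 : (0 : ℝ) ≤ (2 : ℝ) ^ (j₀ + k) := by positivity
    exact h1.trans (mul_le_mul h3 h2 h4 (by linarith))
  exact ⟨r 0, baseSaturation_of_certificates _ (r 0) hθ1 t r hr1 hsat hcov h0 hstep⟩

/-- Sanity link: the pencil member `(p, q) = (17, 20)` is the landed STAGE-2 family's constant,
`(3·20 + 2·17)/(3·20) = 47/30`. [folklore] -/
theorem pencil_exponent_17_20 : (3 * (20 : ℝ) + 2 * 17) / (3 * 20) = 47 / 30 := by norm_num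

/-! ## The frontier at the class ceiling `(3125/128)^{1/3}` -/

/-- **`Base(θ)` for every `θ > 0` with `θ³ > 3125/128`** (`(3125/128)^{1/3} = (5⁵/2⁷)^{1/3} =
2.90099…`, the twin-class ceiling): pick a pencil member `p/q` strictly between
`κ₀ = (5/2) log₂(5/2) − 5/2` and `min(1, (3/2)(log₂ θ − 1))` (non-empty exactly when
`θ³ > 3125/128`), apply `saturationBase_param`, and enlarge the base (`base_mono`).
[cite: CoppersmithWinograd1990, §8] [cite: AlmanDuanVassilevskaWilliamsXuXuZhou2025, Thm. 3.2, §3.4] -/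
theorem base_of_cube_gt {θ : ℝ} (hθ : 0 < θ) (hcube : (3125 : ℝ) / 128 < θ ^ 3) :
    ∃ C : ℝ, ∀ t : ℝ, 0 ≤ t → t < 1 →
      ∃ r : ℝ, 1 ≤ r ∧ r ≤ C * θ ^ (1 / (1 - t)) ∧ omegaRect ℂ 1 t r ≤ 1 + r := by
  have hl2 := Real.log_two_gt_d9
  have hl2' := Real.log_two_lt_d9
  have hL2 : 0 < Real.log 2 := by linarith
  have hP := log_five_halves_le
  have hP2 : Real.log 2 ≤ Real.log (5 / 2) := Real.log_le_log two_pos (by norm_num)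
  -- `3 log θ > 5 log(5/2) − 2 log 2`
  have hlogθ : 5 * Real.log (5 / 2) - 2 * Real.log 2 < 3 * Real.log θ := by
    have h1 := Real.log_lt_log (by norm_num) hcube
    rw [Real.log_pow, Real.log_div (by norm_num) (by norm_num)] at h1
    have e5 : Real.log (3125 : ℝ) = 5 * Real.log (5 / 2) + 5 * Real.log 2 := by
      rw [show (3125 : ℝ) = (5 / 2 * 2) ^ 5 by norm_num, Real.log_pow,
        Real.log_mul (by norm_num) (by norm_num)]
      push_cast; ring
    have e7 : Real.log (128 : ℝ) = 7 * Real.log 2 := by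
      rw [show (128 : ℝ) = 2 ^ 7 by norm_num, Real.log_pow]; push_cast; ring
    rw [e5, e7] at h1; push_cast at h1; linarith
  -- the window for `κ = p/q`
  set κlo : ℝ := 5 / 2 * Real.log (5 / 2) / Real.log 2 - 5 / 2 with hκlo
  set κhi : ℝ := min 1 (3 / 2 * (Real.log θ / Real.log 2 - 1)) with hκhi
  have hAlo : (5 / 2 * Real.log (5 / 2) / Real.log 2) * Real.log 2 = 5 / 2 * Real.log (5 / 2) :=
    div_mul_cancel₀ _ hL2.ne'
  have hAθ : (Real.log θ / Real.log 2) * Real.log 2 = Real.log θ := div_mul_cancel₀ _ hL2.ne'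
  have hκlo0 : 0 ≤ κlo := by
    rw [hκlo, sub_nonneg, le_div_iff₀ hL2]; linarith
  have hκlo1 : κlo < 1 := by
    rw [hκlo]
    have : 5 / 2 * Real.log (5 / 2) / Real.log 2 < 7 / 2 := by
      rw [div_lt_iff₀ hL2]; linarith
    linarith
  have hκloθ : κlo < 3 / 2 * (Real.log θ / Real.log 2 - 1) := by
    rw [hκlo]
    by_contra hneg
    rw [not_lt] at hneg
    -- multiply by `log 2 > 0`
    have h := mul_le_mul_of_nonneg_right hneg hL2.le
    have e1 : 3 / 2 * (Real.log θ / Real.log 2 - 1) * Real.log 2 =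
        3 / 2 * Real.log θ - 3 / 2 * Real.log 2 := by
      rw [mul_assoc, sub_mul, hAθ]; ring
    have e2 : (5 / 2 * Real.log (5 / 2) / Real.log 2 - 5 / 2) * Real.log 2 =
        5 / 2 * Real.log (5 / 2) - 5 / 2 * Real.log 2 := by
      rw [sub_mul, hAlo]
    rw [e1, e2] at h
    linarith
  have hlohi : κlo < κhi := by rw [hκhi, lt_min_iff]; exact ⟨hκlo1, hκloθ⟩
  -- a rational `p/q` in the window
  obtain ⟨q, hq⟩ := exists_nat_gt (1 / (κhi - κlo))
  have hgap : 0 < κhi - κlo := by linarith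
  have hq' : (0 : ℝ) < q := lt_trans (by positivity) hq
  have hqpos : 0 < q := by exact_mod_cast hq'
  have hq1 : 1 / (q : ℝ) < κhi - κlo := by rwa [one_div_lt hq' hgap]
  set p : ℕ := ⌊κlo * q⌋₊ + 1 with hpdef
  have hp1 : κlo * q < (p : ℝ) := by
    rw [hpdef]; push_cast; exact Nat.lt_floor_add_one _
  have hp2 : (p : ℝ) ≤ κlo * q + 1 := by
    rw [hpdef]; push_cast
    linarith [Nat.floor_le (by positivity : 0 ≤ κlo * q)]
  have hκlt : κlo < (p : ℝ) / q := by rwa [lt_div_iff₀ hq']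
  have hκle : (p : ℝ) / q < κhi := by
    have h : (p : ℝ) / q ≤ κlo + 1 / q := by
      rw [div_le_iff₀ hq', add_mul, one_div_mul_cancel hq'.ne']; exact hp2
    linarith
  have hκ1 : (p : ℝ) / q < 1 := lt_of_lt_of_le hκle (min_le_left _ _)
  have hκθ : (p : ℝ) / q < 3 / 2 * (Real.log θ / Real.log 2 - 1) :=
    lt_of_lt_of_le hκle (min_le_right _ _)
  have hpq : p ≤ q := by
    have h : (p : ℝ) < q := by rwa [div_lt_one hq'] at hκ1
    exact_mod_cast h.le
  -- the threshold hypothesis of the pencil member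
  have hδ : 5 / 2 * Real.log (5 / 2) < (5 / 2 + (p : ℝ) / q) * Real.log 2 := by
    have h : 5 / 2 * Real.log (5 / 2) / Real.log 2 < (p : ℝ) / q + 5 / 2 := by
      rw [hκlo] at hκlt; linarith
    rw [div_lt_iff₀ hL2] at h
    linarith
  -- the pencil base is at most `θ`
  have hle : (2 : ℝ) ^ ((3 * (q : ℝ) + 2 * p) / (3 * q)) ≤ θ := by
    have he : (3 * (q : ℝ) + 2 * p) / (3 * q) = 1 + 2 / 3 * ((p : ℝ) / q) := by
      field_simp; try ring
    have hexp : Real.log 2 * ((3 * (q : ℝ) + 2 * p) / (3 * q)) ≤ Real.log θ := by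
      rw [he]
      -- from `p/q < (3/2)(log θ / log 2 − 1)`: `(1 + (2/3) p/q) log 2 < log θ`
      have h := mul_lt_mul_of_pos_right hκθ hL2
      have e1 : 3 / 2 * (Real.log θ / Real.log 2 - 1) * Real.log 2 =
          3 / 2 * Real.log θ - 3 / 2 * Real.log 2 := by
        rw [mul_assoc, sub_mul, hAθ]; ring
      rw [e1] at h
      nlinarith [h, hL2]
    have h := Real.exp_le_exp.2 hexp
    rwa [← Real.rpow_def_of_pos two_pos, Real.exp_log hθ] at h
  exact base_mono (by positivity) hle (saturationBase_param p q hqpos hpq hδ)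

/-- `Base(2.901)` (`2.901³ = 24.4142… > 3125/128 = 24.4140625`). [folklore] -/
theorem base_2901 :
    ∃ C : ℝ, ∀ t : ℝ, 0 ≤ t → t < 1 →
      ∃ r : ℝ, 1 ≤ r ∧ r ≤ C * (2901 / 1000 : ℝ) ^ (1 / (1 - t)) ∧
        omegaRect ℂ 1 t r ≤ 1 + r :=
  base_of_cube_gt (by norm_num) (by norm_num)

/-- … while `2.9³ = 24.389 < 3125/128`: the base `2.9` is NOT reached by the pencil (the class
ceiling `(3125/128)^{1/3}` lies in `(2.9, 2.901)`). [folklore] -/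
theorem cube_29_lt_ceiling : (29 / 10 : ℝ) ^ 3 < 3125 / 128 := by norm_num

/-- The gen-11 frontier is a corollary: `(2^{47/30})³ = 2^{4.7} > 3125/128`, indeed already
`2.962³ > 3125/128`. [folklore] -/
theorem cube_2962_gt_ceiling : (3125 : ℝ) / 128 < (2962 / 1000 : ℝ) ^ 3 := by norm_num

/-- **The crux from the grades up to the class ceiling**: if `Base(θ)` holds for every `θ > 1` with
`θ³ ≤ 3125/128`, then `SubexpSaturation` (stmt-MatrixMultiplication-25909) — every grade with
`θ³ > 3125/128` is a theorem (`base_of_cube_gt`) and the crux is the conjunction of all grades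
`θ > 1` (`subexpSaturation_iff_forall_base`). [cite: AlmanDuanVassilevskaWilliamsXuXuZhou2025, §3.4] -/
theorem subexpSaturation_of_base_cube_le
    (h : ∀ θ : ℝ, 1 < θ → θ ^ 3 ≤ 3125 / 128 → ∃ C : ℝ, ∀ t : ℝ, 0 ≤ t → t < 1 →
      ∃ r : ℝ, 1 ≤ r ∧ r ≤ C * θ ^ (1 / (1 - t)) ∧ omegaRect ℂ 1 t r ≤ 1 + r) :
    SubexpSaturation := by
  rw [subexpSaturation_iff_forall_base]
  intro θ hθ
  by_cases hc : θ ^ 3 ≤ 3125 / 128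
  · exact h θ hθ hc
  · exact base_of_cube_gt (by linarith) (lt_of_not_ge hc)

/-- **The open content of the crux, exactly**: `SubexpSaturation ⟺ ∀ θ > 1, θ³ ≤ 3125/128 → Base(θ)`
— the grades `θ ∈ (1, (3125/128)^{1/3}]`, none of which has a twin-type certificate.
[cite: AlmanDuanVassilevskaWilliamsXuXuZhou2025, §3.4] -/
theorem subexpSaturation_iff_base_cube_le :
    SubexpSaturation ↔ ∀ θ : ℝ, 1 < θ → θ ^ 3 ≤ 3125 / 128 → ∃ C : ℝ, ∀ t : ℝ, 0 ≤ t → t < 1 →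
      ∃ r : ℝ, 1 ≤ r ∧ r ≤ C * θ ^ (1 / (1 - t)) ∧ omegaRect ℂ 1 t r ≤ 1 + r :=
  ⟨fun h θ hθ _ => (subexpSaturation_iff_forall_base.1 h) θ hθ, subexpSaturation_of_base_cube_le⟩

end Summit.MatrixMultiplication.MatrixMultiplication.Theorems.SaturationLadderTwinCeiling
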